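import Summits.AtomisticToContinuum.BoseEinsteinCondensation.Theorems.BECProbeMassFlowRecoilTransferL2SublatticeBands
import Summits.AtomisticToContinuum.BoseEinsteinCondensation.Theorems.BECConjugateDominationHardCoreExtensionMaxFormSimpleOfPositive
import HarnessLib

/-!
# Route `BECProbeMassFlow`, crux `RecoilTransfer` (stmt-AtomisticToContinuum-12311):
# stub `stub_groundStatesTranslationInvariant` (D′α) — every maximal-form ground state has total momentum zero

Support file for the crux `RecoilTransfer` (route `BECProbeMassFlow`, line `registered`, skeleton
`Cruxes/RecoilTransfer/Lines/birth.lean` v6): the stub `stub_groundStatesTranslationInvariant` (exact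
registered name and signature). For a repulsive finite-range pair profile `v` (hard cores `v = ⊤`, hard
shells, non-integrable singularities allowed), `0 < L` and finite `E₀ = periodicGroundStateEnergy v M L`,
**every element of the ground-state class `maxFormGroundStates v M L` of the maximal form in the Bose sector
is invariant under all diagonal translations `translateLp b`, `b ∈ (ℝ/ℤ)³`** — also when the ground level
is DEGENERATE (no Perron–Frobenius / Ky Fan gap, no connectivity of the hard-sphere configuration space).

Mechanism (sequel of `…RecoilTransferL2SublatticeAtoms.lean`, `…RecoilTransferL2SublatticeBands.lean`):
* `translateLp_atom_eq_self` — an atom `h` of a sublattice `V ⊆ L²((ℝ/ℤ)^{3M})` stable under the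
  translations is fixed: `T_b h` is an atom (`atom_translateLp`), atoms are proportional or orthogonal, the
  set `{b | T_b h ⊥ h}` is clopen (continuity of the matrix coefficients) and misses `0`, and `(ℝ/ℤ)³` is
  connected;
* `translateLp_eq_self_of_mem_sublattice` — induction on the dimension through the orthogonal complement
  of an atom inside `V` (again a sublattice, `atom_inner_absLp_eq_zero`);
* `finiteDimensional_of_maxFormKin_le` — a subspace on which `maxFormKin L ≤ E ‖·‖²` with `E < ⊤` is
  finite-dimensional (vanishing of the low Fourier coefficients forces `‖f‖² ≤ E‖f‖²/(E+1)` by Parseval);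
* the ground-state class is such a sublattice: a `ℂ`-subspace by the parallelogram law and the
  finite-range maximal-form bound (sibling `add_mem_maxFormGroundStates_fr`, hard cores allowed), closed
  under `conj`, `|·|` (`PeriodicMaxFormGroundStates.lean`) and the translations (`maxForm_translateLp`).

References: M. Reed, B. Simon, *Methods of Modern Mathematical Physics IV* (1978), §XIII.12,
Thms XIII.43–XIII.44 (Beurling–Deny lattice structure of the ground-state space) [ReedSimonIV1978];
§XIII.16 (translation-invariant operators).
-/

noncomputable section

namespace Summit.AtomisticToContinuum.BoseEinsteinCondensation.Theorems

open MeasureTheory Filter UnitAddTorus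
open scoped ENNReal NNReal InnerProductSpace ComplexConjugate
open Literature.MathematicalPhysics.QuantumManyBody Literature.MathematicalPhysics.QuantumManyBody.BoseGas
open Literature.Analysis.FunctionSpaces Literature.Analysis.OperatorTheory

-- The measure on `ℝ/ℤ` is the Haar PROBABILITY measure, as in `PeriodicFormDomain.lean` and every maximal-form
-- file of the tree (`absLp`, `maxFormGroundStates`, `translateLp` live on `Lp ℂ 2 (volume : Measure (UnitAddTorus _))`).
attribute [local instance] Literature.MathematicalPhysics.QuantumManyBody.BoseGas.formDomain_measureSpace
  Literature.MathematicalPhysics.QuantumManyBody.BoseGas.formDomain_isProbabilityMeasure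
  Literature.MathematicalPhysics.QuantumManyBody.BoseGas.formDomain_isProbabilityMeasure_pi

/-- Local notation for `L²((ℝ/ℤ)^{3M})`, as in the tree files. -/
local notation "L2T " N':max => Lp ℂ 2 (volume : Measure (UnitAddTorus (Fin N' × Fin 3)))

variable {M : ℕ} {L : ℝ} {v : ℝ → ℝ≥0∞}

/-! ### Translations of a sublattice: atoms are fixed -/

/-- **Translates of atoms are atoms** (of a sublattice `V` stable under the diagonal translations):
`T_b` is a linear isometry onto, commuting with `|·|`, with inverse `T_{-b}`. [folklore] -/
theorem atom_translateLp (V : Submodule ℂ (L2T M))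
    (hVT : ∀ (b : UnitAddTorus (Fin 3)), ∀ f ∈ V, translateLp b f ∈ V) {h : L2T M} (hh : h ∈ V) (hh0 : h ≠ 0)
    (hha : absLp h = h)
    (hhe : ∀ k ∈ V, absLp k = k → (∃ C : ℝ, absLp ((C : ℂ) • h - k) = (C : ℂ) • h - k) → ∃ c : ℝ, k = (c : ℂ) • h)
    (b : UnitAddTorus (Fin 3)) :
    translateLp b h ∈ V ∧ translateLp b h ≠ 0 ∧ absLp (translateLp b h) = translateLp b h ∧
      ∀ k ∈ V, absLp k = k → (∃ C : ℝ, absLp ((C : ℂ) • translateLp b h - k) = (C : ℂ) • translateLp b h - k) →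
        ∃ c : ℝ, k = (c : ℂ) • translateLp b h := by
  refine ⟨hVT b h hh, fun h0 => hh0 ?_, by rw [absLp_translateLp, hha], fun k hkV hka ⟨C, hC⟩ => ?_⟩
  · have h1 := norm_translateLp b h
    rw [h0, norm_zero] at h1
    exact norm_eq_zero.1 h1.symm
  · -- pull back by `T_{-b}`
    have hk' : absLp (translateLp (-b) k) = translateLp (-b) k := by rw [absLp_translateLp, hka]
    have hCk' : absLp ((C : ℂ) • h - translateLp (-b) k) = (C : ℂ) • h - translateLp (-b) k := by
      have h1 : (C : ℂ) • h - translateLp (-b) k = translateLp (-b) ((C : ℂ) • translateLp b h - k) := by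
        rw [map_sub, LinearIsometry.map_smul, translateLp_neg_translateLp]
      rw [h1, absLp_translateLp, hC]
    obtain ⟨c, hc⟩ := hhe _ (hVT (-b) k hkV) hk' ⟨C, hCk'⟩
    refine ⟨c, ?_⟩
    rw [← translateLp_translateLp_neg b k, hc, LinearIsometry.map_smul]

/-- **Atoms are translation invariant.** For an atom `h` of a sublattice `V` stable under the diagonal
translations, the set `{b | T_b h ⊥ h}` is closed (continuity of `b ↦ ⟪h, T_b h⟫`) and open (near such a
`b₀`, the atom `T_b h` is not orthogonal, hence proportional, to the atom `T_{b₀} h ⊥ h`), and misses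
`b = 0`; the torus `(ℝ/ℤ)³` being connected it is empty, so `T_b h = c h` for every `b`, with `c = 1` as
`T_b h ≥ 0` has the norm of `h`. [folklore] -/
theorem translateLp_atom_eq_self (V : Submodule ℂ (L2T M)) (hVa : ∀ f ∈ V, absLp f ∈ V)
    (hVT : ∀ (b : UnitAddTorus (Fin 3)), ∀ f ∈ V, translateLp b f ∈ V) {h : L2T M} (hh : h ∈ V) (hh0 : h ≠ 0)
    (hha : absLp h = h)
    (hhe : ∀ k ∈ V, absLp k = k → (∃ C : ℝ, absLp ((C : ℂ) • h - k) = (C : ℂ) • h - k) → ∃ c : ℝ, k = (c : ℂ) • h)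
    (b : UnitAddTorus (Fin 3)) : translateLp b h = h := by
  -- the set where `T_b h ⊥ h` is clopen and misses `0`, hence empty
  have hSc : IsClosed {b : UnitAddTorus (Fin 3) | ⟪h, translateLp b h⟫_ℂ = 0} :=
    isClosed_eq (continuous_inner_translateLp h h) continuous_const
  have hSo : IsOpen {b : UnitAddTorus (Fin 3) | ⟪h, translateLp b h⟫_ℂ = 0} := by
    rw [isOpen_iff_forall_mem_open]
    intro b₀ hb₀
    have hb₀' : ⟪h, translateLp b₀ h⟫_ℂ = 0 := hb₀
    obtain ⟨h1, h2, h3, h4⟩ := atom_translateLp V hVT hh hh0 hha hhe b₀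
    refine ⟨{b | ⟪translateLp b₀ h, translateLp b h⟫_ℂ ≠ 0}, fun b hb => ?_,
      isOpen_ne_fun (continuous_inner_translateLp _ h) continuous_const, ?_⟩
    · -- the atom `T_b h` is not orthogonal to the atom `T_{b₀} h ⊥ h`, hence proportional to it
      obtain ⟨k1, -, k3, k4⟩ := atom_translateLp V hVT hh hh0 hha hhe b
      rcases atom_smul_or_inner_eq_zero V hVa h1 h3 h4 k1 k3 k4 with ⟨c, hc⟩ | horth
      · show ⟪h, translateLp b h⟫_ℂ = 0
        rw [hc, inner_smul_right, hb₀', mul_zero]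
      · exact absurd horth hb
    · show ⟪translateLp b₀ h, translateLp b₀ h⟫_ℂ ≠ 0
      exact inner_self_ne_zero.2 h2
  have hSe : {b : UnitAddTorus (Fin 3) | ⟪h, translateLp b h⟫_ℂ = 0} = ∅ := by
    rcases isClopen_iff.1 ⟨hSc, hSo⟩ with h1 | h1
    · exact h1
    · have h0 : (0 : UnitAddTorus (Fin 3)) ∈ {b : UnitAddTorus (Fin 3) | ⟪h, translateLp b h⟫_ℂ = 0} := by
        rw [h1]
        exact Set.mem_univ _
      have h0' : ⟪h, translateLp 0 h⟫_ℂ = 0 := h0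
      rw [translateLp_zero] at h0'
      exact absurd h0' (inner_self_ne_zero.2 hh0)
  have hb : ⟪h, translateLp b h⟫_ℂ ≠ 0 := fun h0 => by
    have h1 : b ∈ {b : UnitAddTorus (Fin 3) | ⟪h, translateLp b h⟫_ℂ = 0} := h0
    rw [hSe] at h1
    exact h1
  -- so `T_b h = c h`, and `c = 1`
  obtain ⟨k1, -, k3, k4⟩ := atom_translateLp V hVT hh hh0 hha hhe b
  rcases atom_smul_or_inner_eq_zero V hVa hh hha hhe k1 k3 k4 with ⟨c, hc⟩ | horth
  · have hn := norm_translateLp b h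
    rw [hc, norm_smul, Complex.norm_real, Real.norm_eq_abs] at hn
    have habs : |c| = 1 := mul_right_cancel₀ (norm_ne_zero_iff.2 hh0) (hn.trans (one_mul _).symm)
    rcases (abs_eq zero_le_one).1 habs with h1 | h1
    · rw [hc, h1, Complex.ofReal_one, one_smul]
    · exfalso
      rw [h1, Complex.ofReal_neg, Complex.ofReal_one, neg_smul, one_smul] at hc
      rw [hc, absLp_neg, hha] at k3
      -- `k3 : h = -h`
      refine hh0 ((smul_eq_zero.1 (?_ : (2 : ℂ) • h = 0)).resolve_left two_ne_zero)
      rw [two_smul]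
      nth_rewrite 2 [k3]
      exact add_neg_cancel h
  · exact absurd horth hb

/-- **A finite-dimensional sublattice of `L²((ℝ/ℤ)^{3M})` stable under complex conjugation, `|·|` and the
diagonal translations is fixed pointwise by the translations.** Induction on the dimension: an atom `h`
is fixed (`translateLp_atom_eq_self`), and `V ∩ h^⊥` is a smaller sublattice of the same kind
(`atom_inner_absLp_eq_zero`; `T_b` is unitary and fixes `h`). [folklore] -/
theorem translateLp_eq_self_of_mem_sublattice (d : ℕ) :
    ∀ (V : Submodule ℂ (L2T M)) [FiniteDimensional ℂ V], Module.finrank ℂ V = d →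
      (∀ f ∈ V, conjLp f ∈ V) → (∀ f ∈ V, absLp f ∈ V) →
      (∀ (b : UnitAddTorus (Fin 3)), ∀ f ∈ V, translateLp b f ∈ V) →
      ∀ f ∈ V, ∀ b : UnitAddTorus (Fin 3), translateLp b f = f := by
  refine Nat.strong_induction_on d fun d ih => ?_
  intro V _ hd hVc hVa hVT f hf b
  by_cases hV : V = ⊥
  · rw [hV, Submodule.mem_bot] at hf
    rw [hf, map_zero]
  obtain ⟨h, hh, hh0, hha, hhe⟩ := exists_atom V hVa hV
  have hTh : ∀ b' : UnitAddTorus (Fin 3), translateLp b' h = h :=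
    translateLp_atom_eq_self V hVa hVT hh hh0 hha hhe
  -- the orthogonal complement `V' = V ∩ h^⊥` of the atom inside `V`
  have hmem : ∀ g : L2T M, g ∈ (V ⊓ (ℂ ∙ h)ᗮ : Submodule ℂ (L2T M)) ↔ g ∈ V ∧ ⟪h, g⟫_ℂ = 0 := fun g => by
    rw [Submodule.mem_inf, Submodule.mem_orthogonal_singleton_iff_inner_right]
  have hlt : Module.finrank ℂ (V ⊓ (ℂ ∙ h)ᗮ : Submodule ℂ (L2T M)) < d := by
    rw [← hd]
    refine Submodule.finrank_lt_finrank_of_lt (lt_of_le_of_ne inf_le_left fun heq => hh0 ?_)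
    have h1 : h ∈ (V ⊓ (ℂ ∙ h)ᗮ : Submodule ℂ (L2T M)) := by
      rw [heq]
      exact hh
    exact inner_self_eq_zero.1 ((hmem h).1 h1).2
  have hV'c : ∀ g ∈ (V ⊓ (ℂ ∙ h)ᗮ : Submodule ℂ (L2T M)), conjLp g ∈ (V ⊓ (ℂ ∙ h)ᗮ : Submodule ℂ (L2T M)) := by
    intro g hg
    rw [hmem] at hg ⊢
    refine ⟨hVc g hg.1, ?_⟩
    rw [← conjLp_eq_self_of_absLp_eq hha, inner_conjLp_conjLp, hg.2, map_zero]
  have hV'a : ∀ g ∈ (V ⊓ (ℂ ∙ h)ᗮ : Submodule ℂ (L2T M)), absLp g ∈ (V ⊓ (ℂ ∙ h)ᗮ : Submodule ℂ (L2T M)) := by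
    intro g hg
    rw [hmem] at hg ⊢
    exact ⟨hVa g hg.1, atom_inner_absLp_eq_zero V hVc hVa hh hh0 hha hhe hg.1 hg.2⟩
  have hV'T : ∀ (b' : UnitAddTorus (Fin 3)), ∀ g ∈ (V ⊓ (ℂ ∙ h)ᗮ : Submodule ℂ (L2T M)),
      translateLp b' g ∈ (V ⊓ (ℂ ∙ h)ᗮ : Submodule ℂ (L2T M)) := by
    intro b' g hg
    rw [hmem] at hg ⊢
    refine ⟨hVT b' g hg.1, ?_⟩
    rw [← hTh b', LinearIsometry.inner_map_map, hg.2]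
  -- `f = γ h + (f - γ h)` with `f - γ h ∈ V'`
  have hf' : f - (⟪h, f⟫_ℂ / ⟪h, h⟫_ℂ) • h ∈ (V ⊓ (ℂ ∙ h)ᗮ : Submodule ℂ (L2T M)) := by
    rw [hmem]
    refine ⟨V.sub_mem hf (V.smul_mem _ hh), ?_⟩
    rw [inner_sub_right, inner_smul_right, div_mul_cancel₀ _ (inner_self_ne_zero.2 hh0), sub_self]
  have h1 := ih _ hlt (V ⊓ (ℂ ∙ h)ᗮ) rfl hV'c hV'a hV'T _ hf' b
  rw [map_sub, LinearIsometry.map_smul, hTh b, sub_left_inj] at h1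
  exact h1

/-! ### Finite-dimensionality from a kinetic-energy bound -/

/-- **Subspaces of uniformly bounded kinetic energy are finite-dimensional.** If every `f` in a subspace
`V ⊆ L²((ℝ/ℤ)^{3M})` has `maxFormKin L f ≤ E ‖f‖²` with `E < ⊤`, then `V` is finite-dimensional: for a
frequency box `F_R` with `(2π/L)²(R+1)² ≥ E + 1`, an `f ∈ V` whose coefficients `⟪eₙ, f⟫`, `n ∈ F_R`,
vanish has `‖f‖² ≤ E ‖f‖² / (E + 1)` (Parseval), so `f = 0`, and `V` embeds into `ℂ^{F_R}`.
[folklore] -/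
theorem finiteDimensional_of_maxFormKin_le {L : ℝ} (hL : 0 < L) {E : ℝ≥0∞} (hE : E ≠ ⊤)
    (V : Submodule ℂ (L2T M)) (hV : ∀ f ∈ V, maxFormKin L f ≤ E * ENNReal.ofReal (‖f‖ ^ 2)) :
    FiniteDimensional ℂ V := by
  classical
  -- a frequency cutoff `R` with `E + 1 ≤ ρ = (2π/L)² (R+1)²`
  obtain ⟨R, hR⟩ := exists_nat_ge ((E.toReal + 1) / (2 * Real.pi / L) ^ 2)
  have hπL : 0 < (2 * Real.pi / L) ^ 2 := by positivity
  set ρ : ℝ := (2 * Real.pi / L) ^ 2 * ((R : ℝ) + 1) ^ 2 with hρ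
  have hEρ : E.toReal + 1 ≤ ρ := by
    rw [div_le_iff₀ hπL] at hR
    have h1 : (R : ℝ) ≤ ((R : ℝ) + 1) ^ 2 := by nlinarith [R.cast_nonneg (α := ℝ)]
    calc E.toReal + 1 ≤ (R : ℝ) * (2 * Real.pi / L) ^ 2 := hR
      _ ≤ ((R : ℝ) + 1) ^ 2 * (2 * Real.pi / L) ^ 2 := mul_le_mul_of_nonneg_right h1 hπL.le
      _ = ρ := by rw [hρ, mul_comm]
  have hρ0 : 0 < ρ := by linarith [E.toReal_nonneg]
  -- the low-frequency coefficient map `Φ : V → ℂ^{F_R}` is injective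
  let Φ : V →ₗ[ℂ] (↥(lowFreq M R) → ℂ) :=
    { toFun := fun f n => ⟪(mFourierLp 2 (n : Fin M × Fin 3 → ℤ) : L2T M), (f : L2T M)⟫_ℂ
      map_add' := fun f g => funext fun n => by
        simp only [Submodule.coe_add, inner_add_right, Pi.add_apply]
      map_smul' := fun c f => funext fun n => by
        simp only [Submodule.coe_smul, inner_smul_right, Pi.smul_apply, smul_eq_mul, RingHom.id_apply] }
  refine FiniteDimensional.of_injective Φ ((injective_iff_map_eq_zero Φ).2 fun f hf => ?_)
  have hcoef : ∀ n ∈ lowFreq M R, ⟪(mFourierLp 2 n : L2T M), (f : L2T M)⟫_ℂ = 0 := fun n hn =>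
    congr_fun hf ⟨n, hn⟩
  set x : L2T M := (f : L2T M) with hx
  -- Parseval in `ℝ≥0∞`
  have hpars : ENNReal.ofReal (‖x‖ ^ 2) = ∑' n : Fin M × Fin 3 → ℤ,
      ((‖⟪(mFourierLp 2 n : L2T M), x⟫_ℂ‖₊ : ℝ≥0∞)) ^ 2 := by
    rw [← (HaarTorus.hasSum_sq_norm_inner_mFourierLp x).tsum_eq, ENNReal.ofReal_tsum_of_nonneg
      (fun n => sq_nonneg _) (HaarTorus.hasSum_sq_norm_inner_mFourierLp x).summable]
    exact tsum_congr fun n => (coe_nnnorm_sq_eq_ofReal _).symm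
  -- termwise: `|⟪eₙ, x⟫|² ≤ ρ⁻¹ (∑ₚ (2πnₚ/L)²) |⟪eₙ, x⟫|²`
  have hterm : ∀ n : Fin M × Fin 3 → ℤ, ((‖⟪(mFourierLp 2 n : L2T M), x⟫_ℂ‖₊ : ℝ≥0∞)) ^ 2 ≤
      (ENNReal.ofReal ρ)⁻¹ * (ENNReal.ofReal (∑ p, (2 * Real.pi * (n p : ℝ) / L) ^ 2) *
        ((‖⟪(mFourierLp 2 n : L2T M), x⟫_ℂ‖₊ : ℝ≥0∞)) ^ 2) := by
    intro n
    by_cases hn : n ∈ lowFreq M R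
    · rw [hcoef n hn, nnnorm_zero, ENNReal.coe_zero, zero_pow two_ne_zero]
      exact bot_le
    · have hwn : ρ ≤ ∑ p, (2 * Real.pi * (n p : ℝ) / L) ^ 2 := by
        have h1 := sq_le_sum_sq_of_not_mem_lowFreq hn
        have h2 : ∑ p, (2 * Real.pi * (n p : ℝ) / L) ^ 2 = (2 * Real.pi / L) ^ 2 * ∑ p, ((n p : ℝ)) ^ 2 := by
          rw [Finset.mul_sum]
          refine Finset.sum_congr rfl fun p _ => ?_
          ring
        rw [h2, hρ]
        exact mul_le_mul_of_nonneg_left h1 hπL.le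
      calc ((‖⟪(mFourierLp 2 n : L2T M), x⟫_ℂ‖₊ : ℝ≥0∞)) ^ 2
          = (ENNReal.ofReal ρ)⁻¹ * (ENNReal.ofReal ρ * ((‖⟪(mFourierLp 2 n : L2T M), x⟫_ℂ‖₊ : ℝ≥0∞)) ^ 2) := by
            rw [← mul_assoc, ENNReal.inv_mul_cancel ((ENNReal.ofReal_pos.2 hρ0).ne') ENNReal.ofReal_ne_top, one_mul]
        _ ≤ _ := by
            have hwn' := ENNReal.ofReal_le_ofReal hwn
            gcongr
  -- sum: `‖x‖² ≤ ρ⁻¹ maxFormKin ≤ ρ⁻¹ E ‖x‖²`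
  have hsum : ENNReal.ofReal (‖x‖ ^ 2) ≤ (ENNReal.ofReal ρ)⁻¹ * E * ENNReal.ofReal (‖x‖ ^ 2) := by
    calc ENNReal.ofReal (‖x‖ ^ 2) = ∑' n : Fin M × Fin 3 → ℤ, ((‖⟪(mFourierLp 2 n : L2T M), x⟫_ℂ‖₊ : ℝ≥0∞)) ^ 2 :=
          hpars
      _ ≤ ∑' n : Fin M × Fin 3 → ℤ, (ENNReal.ofReal ρ)⁻¹ * (ENNReal.ofReal (∑ p, (2 * Real.pi * (n p : ℝ) / L) ^ 2) *
            ((‖⟪(mFourierLp 2 n : L2T M), x⟫_ℂ‖₊ : ℝ≥0∞)) ^ 2) := ENNReal.tsum_le_tsum hterm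
      _ = (ENNReal.ofReal ρ)⁻¹ * maxFormKin L x := by rw [ENNReal.tsum_mul_left]; rfl
      _ ≤ (ENNReal.ofReal ρ)⁻¹ * (E * ENNReal.ofReal (‖x‖ ^ 2)) := by gcongr; exact hV x f.2
      _ = (ENNReal.ofReal ρ)⁻¹ * E * ENNReal.ofReal (‖x‖ ^ 2) := (mul_assoc _ _ _).symm
  -- `ρ⁻¹ E < 1`, so `‖x‖ = 0`
  have hx0 : ENNReal.ofReal (‖x‖ ^ 2) = 0 := by
    by_contra h0
    have h1 : 1 ≤ (ENNReal.ofReal ρ)⁻¹ * E := by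
      rw [← ENNReal.mul_le_mul_iff_left h0 ENNReal.ofReal_ne_top, one_mul]
      exact hsum
    have h2 : ENNReal.ofReal ρ ≤ E := by
      calc ENNReal.ofReal ρ = ENNReal.ofReal ρ * 1 := (mul_one _).symm
        _ ≤ ENNReal.ofReal ρ * ((ENNReal.ofReal ρ)⁻¹ * E) := by gcongr
        _ = E := by
            rw [← mul_assoc, ENNReal.mul_inv_cancel ((ENNReal.ofReal_pos.2 hρ0).ne') ENNReal.ofReal_ne_top, one_mul]
    rw [← ENNReal.ofReal_toReal hE, ENNReal.ofReal_le_ofReal_iff ENNReal.toReal_nonneg] at h2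
    linarith
  have hx0' : x = 0 := by
    rw [ENNReal.ofReal_eq_zero] at hx0
    exact norm_eq_zero.1 (by nlinarith [norm_nonneg x])
  rw [hx] at hx0'
  exact_mod_cast hx0'

/-! ### The ground-state class and the stub -/


/-- **The ground-state class is stable under the diagonal translations** (the maximal form, the norm and
the Bose sector are). [folklore] -/
theorem translateLp_mem_maxFormGroundStates (hL : 0 < L) (b : UnitAddTorus (Fin 3))
    {η : Lp ℂ 2 (volume : Measure (UnitAddTorus (Fin M × Fin 3)))} (hη : η ∈ maxFormGroundStates v M L) :
    translateLp b η ∈ maxFormGroundStates v M L :=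
  ⟨translateLp_mem_boseSymmetric b hη.1, by rw [maxForm_translateLp hL, norm_translateLp]; exact hη.2⟩


open Summit.AtomisticToContinuum.BoseEinsteinCondensation.Cruxes.HardCoreExtension.ThirdLawCurrentFloorAlt
  (add_mem_maxFormGroundStates_fr) in
/-- **Stub D′α `stub_groundStatesTranslationInvariant` — every maximal-form ground state has total
momentum zero** (all repulsive finite-range profiles, hard walls included; fixed `(M, L)`, no density
condition, no connectivity input). For a repulsive finite-range `v`, `0 < L` and finite
`E₀ = periodicGroundStateEnergy v M L`, every element of the ground-state class `maxFormGroundStates v M L`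
is invariant under all diagonal translations `translateLp b`: the class is a `ℂ`-subspace (parallelogram
law and the finite-range maximal-form bound, `add_mem_maxFormGroundStates_fr`), finite-dimensional
(`finiteDimensional_of_maxFormKin_le`, as `maxFormKin ≤ maxForm ≤ E₀‖·‖²`), closed under `conj`, `|·|`
and the translations, so `translateLp_eq_self_of_mem_sublattice` applies. (The range `R₀` and
`2R₀ < L` of the registered signature are not used.) [cite: ReedSimonIV1978, §XIII.12 Thms XIII.43–XIII.44] -/
theorem stub_groundStatesTranslationInvariant :
    ∀ v : ℝ → ℝ≥0∞, IsRepulsiveFiniteRange v → ∀ R₀ : ℝ, (∀ r : ℝ, R₀ < r → v r = 0) →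
      ∀ (M : ℕ) (L : ℝ), 0 < L → 2 * R₀ < L → periodicGroundStateEnergy v M L ≠ ⊤ →
        ∀ η : Lp ℂ 2 (volume : Measure (UnitAddTorus (Fin M × Fin 3))),
          η ∈ maxFormGroundStates v M L → ∀ b : UnitAddTorus (Fin 3), translateLp b η = η := by
  intro v hvfr _ _ M L hL _ hE η hη b
  let V : Submodule ℂ (Lp ℂ 2 (volume : Measure (UnitAddTorus (Fin M × Fin 3)))) :=
    { carrier := maxFormGroundStates v M L
      zero_mem' := zero_mem_maxFormGroundStates v M L
      add_mem' := fun ha hb => add_mem_maxFormGroundStates_fr hL hvfr hE ha hb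
      smul_mem' := fun c _ hx => smul_mem_maxFormGroundStates c hx }
  haveI : FiniteDimensional ℂ V := finiteDimensional_of_maxFormKin_le hL hE V fun f hf =>
    le_trans (self_le_add_right _ _) hf.2
  exact translateLp_eq_self_of_mem_sublattice _ V rfl (fun f hf => conjLp_mem_maxFormGroundStates hf)
    (fun f hf => absLp_mem_maxFormGroundStates hf) (fun b' f hf => translateLp_mem_maxFormGroundStates hL b' hf)
    η hη b

end Summit.AtomisticToContinuum.BoseEinsteinCondensation.Theorems
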